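import Literature.Probability.Process.HarrisTheorem
import HarnessLib

/-!
# Harris' theorem for a continuous-time Markov semigroup via its skeleton chain

Trunk T-STOCH (Literature/Probability/Process). Theorems only. For a semigroup of Markov kernels
`(κ t)_{t ≥ 0}` (`κ 0 = id`, Chapman–Kolmogorov `κ (s+t) = κ t ∘ₖ κ s`) with a Lyapunov function
`V : X → ℝ≥0` satisfying

* a GEOMETRIC DRIFT at one time `t₁ > 0`: `κ t₁ V ≤ a V + b₀` with `a < 1`;
* a MINORISATION on the sublevel sets of `V` for all large times: for every `R` there is `t_R`
  such that for `t ≥ t_R` some non-zero measure `ν` has `ν ≤ κ t (z, ·)` whenever `V z ≤ R`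
  ("every sublevel set of `V` is small");
* (for continuous time) an EXPONENTIAL FLOW BOUND `κ s V ≤ e^{C⋆ s} V` for all `s`,

the skeleton chain `κ (m t₁) = (κ t₁)ᵐ`, `m` large, satisfies Assumptions 1–2 of Hairer–Mattingly
(`Literature.Probability.Process.Harris.harris`), whence: the semigroup has at most one invariant
probability measure; an invariant probability measure `μ` has `∫ V dμ < ∞`; and for every
measurable `f` with `|f| ≤ V`, `|κ t f (z) - μ(f)| ≤ C (1 + V z) e^{-ct}` for all `z` and ALL
`t ≥ 0` (interpolating between skeleton times with the flow bound and the Markov property).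

This is the abstract content of Rey-Bellet–Thomas 2002, §5 (Theorem 5.1, quoted from
Meyn–Tweedie, for the time-`s` skeleton, and the continuous-time step "for `t = ns + r` …
`‖P_t - μ‖ ≤ ‖P_{ns} - μ‖ ‖P_r‖`" of the proof of Theorem 2.1) and of Cuneo–Eckmann–Hairer–
Rey-Bellet 2018, proof of Prop. 3.8; the latter was formalised for the pinned Langevin chain in
`Literature/MathematicalPhysics/KineticTheory/LangevinChainHarris.lean`, of which this file is the
model-free version (same proofs, unbundled kernels as in `KrylovBogoliubov.lean`/`SmallSets.lean`).

## Main results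

* `kernel_nat_mul_eq_pow` — the skeleton `κ (n t₀) = (κ t₀)ⁿ`.
* `harris_skeleton` — Harris' theorem for `κ (m t₁)`, `m ≥ 1` large: uniqueness of its invariant
  probability measure, finite `V`-moment and geometric convergence for every invariant one.
* `invariant_unique_of_drift_of_minorization` — at most one invariant probability measure of the
  semigroup.
* `lintegral_ne_top_of_invariant` — `∫⁻ V dμ < ∞` for an invariant probability measure.
* `exp_convergence_of_drift_of_minorization` — `|κ t f(z) - μ(f)| ≤ C (1 + V z) e^{-ct}`.

## References

* L. Rey-Bellet, L. E. Thomas, Comm. Math. Phys. **225** (2002) 305–329, §5 (Thm 5.1 and the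
  proof of Thm 2.1).
* M. Hairer, J. C. Mattingly, *Yet another look at Harris' ergodic theorem for Markov chains*,
  Progr. Probab. 63 (2011) 109–117, Thms 1.2–1.3.
* S. P. Meyn, R. L. Tweedie, *Markov Chains and Stochastic Stability* (1993), Thm 15.0.1.
-/

noncomputable section

open MeasureTheory ProbabilityTheory Filter Set
open scoped NNReal ENNReal Topology

namespace Literature.Probability.Process.MarkovSemigroup

variable {X : Type*} [MeasurableSpace X]

/-! ### The skeleton chain -/

/-- **The skeleton chain**: `κ (n t₀) = (κ t₀)ⁿ` (Chapman–Kolmogorov; Mathlib's monoid powers of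
kernels). [folklore] -/
theorem kernel_nat_mul_eq_pow (κ : ℝ≥0 → Kernel X X) (h_zero : κ 0 = Kernel.id)
    (h_add : ∀ s t : ℝ≥0, κ (s + t) = κ t ∘ₖ κ s) (t₀ : ℝ≥0) (n : ℕ) :
    κ (n * t₀) = κ t₀ ^ n := by
  induction n with
  | zero => rw [Nat.cast_zero, zero_mul, h_zero, pow_zero, Harris.one_eq_id]
  | succ n ih =>
    rw [Nat.cast_succ, add_mul, one_mul, h_add, ih, ← Harris.pow_succ_eq_comp']

/-- Euclidean division of a time by a positive step: `t = r + n t₀` with `r < t₀`. (Same statement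
as `Literature.MathematicalPhysics.KineticTheory.HeatConduction.exists_eq_add_nat_mul_of_pos` of
`LangevinChainHarris.lean`, proved there for the pinned chain's assembly; it is restated in this
model-free file because a `Probability/Process` file must not import the kinetic-theory topic —
the kinetic-theory copy is the one to retire.) [folklore] -/
theorem exists_eq_add_nat_mul_of_pos {t₀ : ℝ≥0} (ht₀ : 0 < t₀) (t : ℝ≥0) :
    ∃ (n : ℕ) (r : ℝ≥0), r < t₀ ∧ t = r + n * t₀ := by
  have h2 : (⌊t / t₀⌋₊ : ℝ≥0) * t₀ ≤ t := by
    calc (⌊t / t₀⌋₊ : ℝ≥0) * t₀ ≤ t / t₀ * t₀ :=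
          mul_le_mul_of_nonneg_right (Nat.floor_le (by positivity)) (by positivity)
      _ = t := div_mul_cancel₀ t ht₀.ne'
  refine ⟨⌊t / t₀⌋₊, t - ⌊t / t₀⌋₊ * t₀, ?_, ?_⟩
  · have h1 : t < (⌊t / t₀⌋₊ + 1 : ℝ≥0) * t₀ := by
      have := Nat.lt_floor_add_one (t / t₀)
      calc t = t / t₀ * t₀ := (div_mul_cancel₀ t ht₀.ne').symm
        _ < _ := mul_lt_mul_of_pos_right (by exact_mod_cast this) ht₀
    rw [tsub_lt_iff_left h2]
    calc t < (⌊t / t₀⌋₊ + 1 : ℝ≥0) * t₀ := h1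
      _ = ⌊t / t₀⌋₊ * t₀ + t₀ := by ring
  · rw [tsub_add_cancel_of_le h2]

/-! ### Harris' theorem for the skeleton -/

section Skeleton

variable (κ : ℝ≥0 → Kernel X X) [∀ t, IsMarkovKernel (κ t)] (h_zero : κ 0 = Kernel.id)
  (h_add : ∀ s t : ℝ≥0, κ (s + t) = κ t ∘ₖ κ s) {V : X → ℝ≥0} (hV : Measurable V)
  {t₁ : ℝ≥0} (ht₁ : 0 < t₁) {a b₀ : ℝ≥0} (ha1 : a < 1)
  (hdrift : ∀ z, ∫⁻ y, V y ∂(κ t₁ z) ≤ (a : ℝ≥0∞) * V z + b₀)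
  (hminor : ∀ R : ℝ≥0, ∃ t_R : ℝ≥0, ∀ t : ℝ≥0, t_R ≤ t →
    ∃ ν : Measure X, ν ≠ 0 ∧ ∀ z, V z ≤ R → ν ≤ κ t z)
include h_zero h_add hV ht₁ ha1 hdrift hminor

/-- **Harris' theorem for the skeleton chain `κ (m t₁)`, `m` large** (Rey-Bellet–Thomas Thm 5.1 /
Meyn–Tweedie Thm 15.0.1 in the form of Hairer–Mattingly Thms 1.2–1.3). The drift at `t₁`,
`κ t₁ V ≤ aV + b₀`, iterates to `κ (m t₁) V ≤ aᵐ V + B`, `B = b₀/(1-a)`; with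
`R = (2B + 1)/(1-a)` the minorisation hypothesis on `{V ≤ R}` provides `t_R`, and for the integer
`m = max(1, ⌈t_R/t₁⌉)` the kernel `P = κ (m t₁)` satisfies Assumptions 1–2 of Hairer–Mattingly
(`γ = aᵐ`, `2B < (1-γ)R`, minorising measure normalised to a probability measure). Conclusions:
`P` has at most one invariant probability measure, and every invariant probability measure `μ`
of `P` has `∫⁻ V dμ < ∞` and `|Pⁿ φ(x) - μ(φ)| ≤ ᾱⁿ (2 + b V(x) + b μ(V))` for measurable
`|φ| ≤ 1 + bV`. [cite: ReyBelletThomas2002, Thm 5.1] [cite: HairerMattingly2011, Theorems 1.2 and 1.3] -/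
theorem harris_skeleton [Nonempty X] :
    ∃ (m : ℕ) (abar b : ℝ), 0 < m ∧ 0 < abar ∧ abar < 1 ∧ 0 < b ∧
      (∀ μ₁ μ₂ : Measure X, IsProbabilityMeasure μ₁ → IsProbabilityMeasure μ₂ →
        Kernel.Invariant (κ (m * t₁)) μ₁ → Kernel.Invariant (κ (m * t₁)) μ₂ → μ₁ = μ₂) ∧
      (∀ μ : Measure X, IsProbabilityMeasure μ → Kernel.Invariant (κ (m * t₁)) μ →
        ∫⁻ z, V z ∂μ ≠ ∞ ∧
        ∀ (n : ℕ) (φ : X → ℝ), Measurable φ → (∀ x, |φ x| ≤ 1 + b * V x) → ∀ x,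
          |∫ z, φ z ∂((κ (m * t₁) ^ n) x) - ∫ z, φ z ∂μ| ≤
            abar ^ n * (2 + b * V x + b * (∫⁻ z, V z ∂μ).toReal)) := by
  -- the skeleton at `m t₁`: drift with `γ = aᵐ`, `K = b₀/(1-a)`
  set B : ℝ≥0 := b₀ / (1 - a) with hB
  have h1a : 0 < 1 - a := tsub_pos_of_lt ha1
  set R : ℝ≥0 := (2 * B + 1) / (1 - a) with hRdef
  have hRa : (1 - a) * R = 2 * B + 1 := by
    rw [hRdef, mul_comm, div_mul_cancel₀ _ h1a.ne']
  obtain ⟨t_R, ht_R⟩ := hminor R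
  set m : ℕ := max 1 ⌈t_R / t₁⌉₊ with hm
  have hm1 : 1 ≤ m := le_max_left _ _
  have hm0 : m ≠ 0 := by omega
  have hmt : t_R ≤ (m : ℝ≥0) * t₁ := by
    have h1 : t_R / t₁ ≤ (m : ℝ≥0) := (Nat.le_ceil _).trans (by exact_mod_cast le_max_right _ _)
    calc t_R = t_R / t₁ * t₁ := (div_mul_cancel₀ t_R ht₁.ne').symm
      _ ≤ (m : ℝ≥0) * t₁ := mul_le_mul_of_nonneg_right h1 zero_le
  obtain ⟨ν, hν0, hνle⟩ := ht_R ((m : ℝ≥0) * t₁) hmt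
  set P : Kernel X X := κ ((m : ℝ≥0) * t₁) with hPdef
  have hPpow : P = κ t₁ ^ m := by rw [hPdef, kernel_nat_mul_eq_pow κ h_zero h_add t₁ m]
  have hdriftP : ∀ z, ∫⁻ y, V y ∂(P z) ≤ ((a ^ m : ℝ≥0) : ℝ≥0∞) * V z + B := by
    intro z
    rw [hPpow, ENNReal.coe_pow]
    exact Harris.lintegral_pow_le_of_drift (κ t₁) hV ha1 hdrift m z
  have hγ1 : a ^ m < 1 := pow_lt_one₀ zero_le ha1 hm0
  have hRcond : 2 * B < (1 - a ^ m) * R := by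
    have ham : a ^ m ≤ a := pow_le_of_le_one zero_le ha1.le hm0
    calc 2 * B < 2 * B + 1 := lt_add_one _
      _ = (1 - a) * R := hRa.symm
      _ ≤ (1 - a ^ m) * R := mul_le_mul_of_nonneg_right (tsub_le_tsub_left ham 1) zero_le
  -- the minorisation, normalised to a probability measure
  have hminor' : ∃ (α : ℝ≥0) (ν' : Measure X), 0 < α ∧ IsProbabilityMeasure ν' ∧
      ∀ x, V x ≤ R → α • ν' ≤ P x := by
    by_cases hC : ({z : X | V z ≤ R}).Nonempty
    · obtain ⟨z₀, hz₀⟩ := hC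
      have hνz₀ : ν ≤ P z₀ := hνle z₀ hz₀
      have hνfin : ν univ ≠ ∞ :=
        ne_top_of_le_ne_top (measure_ne_top (P z₀) univ) (Measure.le_iff'.1 hνz₀ univ)
      haveI : IsFiniteMeasure ν := ⟨lt_top_iff_ne_top.2 hνfin⟩
      have hνuniv : ν univ ≠ 0 := Measure.measure_univ_ne_zero.2 hν0
      refine ⟨(ν univ).toNNReal, (ν univ)⁻¹ • ν, ENNReal.toNNReal_pos hνuniv hνfin,
        ⟨by rw [Measure.smul_apply, smul_eq_mul, ENNReal.inv_mul_cancel hνuniv hνfin]⟩,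
        fun x hx => ?_⟩
      have hsmul : (ν univ).toNNReal • ((ν univ)⁻¹ • ν) = ν := by
        rw [ENNReal.smul_def, ENNReal.coe_toNNReal hνfin, smul_smul,
          ENNReal.mul_inv_cancel hνuniv hνfin, one_smul]
      rw [hsmul]
      exact hνle x hx
    · obtain ⟨x₀⟩ := ‹Nonempty X›
      refine ⟨1, Measure.dirac x₀, one_pos, inferInstance, fun x hx => ?_⟩
      exact absurd ⟨x, hx⟩ hC
  obtain ⟨α, ν', hα, hν', hmin⟩ := hminor'
  haveI := hν'
  obtain ⟨abar, b, h0, h1, hb, -, huniq, hmom⟩ := Harris.harris P hV hγ1 hdriftP hα hRcond hmin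
  refine ⟨m, abar, b, Nat.pos_of_ne_zero hm0, h0, h1, hb, huniq, fun μ hμ hinv => ?_⟩
  obtain ⟨hle, hgeo⟩ := hmom μ hμ hinv
  exact ⟨ne_top_of_le_ne_top ENNReal.coe_ne_top hle, hgeo⟩

/-- **At most one invariant probability measure** for the semigroup (two invariant probability
measures are invariant for the skeleton, hence equal by Harris).
[cite: ReyBelletThomas2002, Thm 5.1] -/
theorem invariant_unique_of_drift_of_minorization [Nonempty X] {μ₁ μ₂ : Measure X}
    [IsProbabilityMeasure μ₁] [IsProbabilityMeasure μ₂] (h₁ : ∀ t, Kernel.Invariant (κ t) μ₁)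
    (h₂ : ∀ t, Kernel.Invariant (κ t) μ₂) : μ₁ = μ₂ := by
  obtain ⟨m, -, -, -, -, -, -, huniq, -⟩ :=
    harris_skeleton κ h_zero h_add hV ht₁ ha1 hdrift hminor
  exact huniq μ₁ μ₂ ‹_› ‹_› (h₁ _) (h₂ _)

/-- **Finite `V`-moment of an invariant probability measure.** [cite: ReyBelletThomas2002, Thm 5.1] -/
theorem lintegral_ne_top_of_invariant [Nonempty X] {μ : Measure X} [IsProbabilityMeasure μ]
    (hinv : ∀ t, Kernel.Invariant (κ t) μ) : ∫⁻ z, V z ∂μ ≠ ∞ := by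
  obtain ⟨m, abar, b, -, -, -, -, -, hmom⟩ :=
    harris_skeleton κ h_zero h_add hV ht₁ ha1 hdrift hminor
  exact (hmom μ ‹_› (hinv _)).1

/-- **Exponential convergence in continuous time** (Rey-Bellet–Thomas, proof of Thm 2.1 in §5:
"for `t = ns + r` … `‖P_t - μ‖ ≤ ‖P_{ns} - μ‖ ‖P_r‖`"; CEHR proof of Prop. 3.8): with, in
addition, the flow bound `κ s V ≤ e^{C⋆ s} V`, every invariant probability measure `μ` satisfies
`|κ t f (z) - μ(f)| ≤ C (1 + V z) e^{-ct}` for all `z`, `t ≥ 0` and measurable `f` with `|f| ≤ V`,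
for some `C, c > 0`. Proof: Harris on the skeleton (`|Pⁿ f(y) - μ(f)| ≤ C₁ ᾱⁿ (1 + V y)`),
then for `t = n t₀ + r`, `r < t₀`, the Markov property and the flow bound give
`|κ t f(z) - μ(f)| ≤ C₁ ᾱⁿ (1 + e^{C⋆ t₀} V z)`, and `ᾱⁿ ≤ ᾱ⁻¹ e^{-ct}`, `c = -log ᾱ / t₀`.
[cite: ReyBelletThomas2002, Thm 2.1 (proof, §5)] -/
theorem exp_convergence_of_drift_of_minorization [Nonempty X] {Cstar : ℝ} (hCstar : 0 ≤ Cstar)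
    (hflow : ∀ (s : ℝ≥0) (x : X),
      ∫⁻ y, V y ∂(κ s x) ≤ ENNReal.ofReal (Real.exp (Cstar * s)) * V x)
    (μ : Measure X) [IsProbabilityMeasure μ] (hinv : ∀ t, Kernel.Invariant (κ t) μ) :
    ∃ C c : ℝ, 0 < C ∧ 0 < c ∧
      ∀ (z : X) (t : ℝ≥0) (f : X → ℝ), Measurable f → (∀ y, |f y| ≤ V y) →
        |∫ y, f y ∂(κ t z) - ∫ y, f y ∂μ| ≤ C * (1 + V z) * Real.exp (-c * t) := by
  obtain ⟨m, abar, b, hm, ha0, ha1', hb, -, hmom⟩ :=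
    harris_skeleton κ h_zero h_add hV ht₁ ha1 hdrift hminor
  obtain ⟨hμV, hgeo⟩ := hmom μ ‹_› (hinv _)
  set t₀ : ℝ≥0 := (m : ℝ≥0) * t₁ with ht₀def
  have ht₀ : 0 < t₀ := mul_pos (by exact_mod_cast hm) ht₁
  set P : Kernel X X := κ t₀ with hPdef
  have ht₀r : (0 : ℝ) < t₀ := by exact_mod_cast ht₀
  set mV : ℝ := (∫⁻ z, V z ∂μ).toReal with hmV
  have hmV0 : 0 ≤ mV := ENNReal.toReal_nonneg
  have hb0 : b ≠ 0 := hb.ne'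
  set C₁ : ℝ := b⁻¹ * (2 + b * mV) + 1 with hC₁def
  have hC₁ : 0 < C₁ := by rw [hC₁def]; positivity
  have hC₁' : b⁻¹ * (2 + b * mV) ≤ C₁ := by rw [hC₁def]; linarith
  have hC₁'' : (1 : ℝ) ≤ C₁ := by rw [hC₁def]; linarith [show (0:ℝ) ≤ b⁻¹ * (2 + b * mV) by positivity]
  set c : ℝ := -Real.log abar / t₀ with hcdef
  have hlog : Real.log abar < 0 := Real.log_neg ha0 ha1'
  have hc : 0 < c := by rw [hcdef]; exact div_pos (by linarith) ht₀r
  refine ⟨C₁ * Real.exp (Cstar * t₀) / abar, c, by positivity, hc, fun z t f hfm hfV => ?_⟩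
  -- finiteness of the `V`-moments along the semigroup
  have hflow' : ∀ (s : ℝ≥0) (x : X), ∫⁻ y, (V y : ℝ≥0∞) ∂(κ s x) ≠ ∞ := fun s x =>
    ne_top_of_le_ne_top (ENNReal.mul_ne_top ENNReal.ofReal_ne_top ENNReal.coe_ne_top) (hflow s x)
  have hfV' : ∀ y, |f y| ≤ 0 + 1 * V y := fun y => by rw [zero_add, one_mul]; exact hfV y
  have hfint : ∀ (s : ℝ≥0) (x : X), Integrable f (κ s x) := fun s x =>
    Harris.integrable_of_abs_le_affine hV (hflow' s x) hfm hfV'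
  -- Harris on the skeleton: `|Pⁿ f(x) - μ(f)| ≤ ᾱⁿ C₁ (1 + V x)`
  have hskel : ∀ (n : ℕ) (x : X),
      |∫ y, f y ∂((P ^ n) x) - ∫ y, f y ∂μ| ≤ abar ^ n * C₁ * (1 + V x) := by
    intro n x
    have hφm : Measurable fun y => b * f y := hfm.const_mul b
    have hφ : ∀ y, |b * f y| ≤ 1 + b * V y := fun y => by
      rw [abs_mul, abs_of_pos hb]
      have := mul_le_mul_of_nonneg_left (hfV y) hb.le
      linarith
    have h := hgeo n (fun y => b * f y) hφm hφ x
    rw [integral_const_mul, integral_const_mul, ← mul_sub, abs_mul, abs_of_pos hb] at h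
    have h' : |∫ y, f y ∂((P ^ n) x) - ∫ y, f y ∂μ| ≤
        abar ^ n * (b⁻¹ * (2 + b * mV) + V x) := by
      have h1 := mul_le_mul_of_nonneg_left h (inv_nonneg.2 hb.le)
      rw [inv_mul_cancel_left₀ hb0] at h1
      refine h1.trans (le_of_eq ?_)
      field_simp
      ring
    refine h'.trans ?_
    rw [mul_assoc]
    refine mul_le_mul_of_nonneg_left ?_ (pow_nonneg ha0.le n)
    have hVx : (0 : ℝ) ≤ V x := (V x).2
    nlinarith
  -- `t = r + n t₀`, `r < t₀`
  obtain ⟨n, r, hr, rfl⟩ := exists_eq_add_nat_mul_of_pos ht₀ t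
  set g : X → ℝ := fun y => ∫ w, f w ∂((P ^ n) y) with hg
  have hgm : Measurable g := (hfm.stronglyMeasurable.integral_kernel (κ := P ^ n)).measurable
  have hact : ∫ y, f y ∂(κ (r + n * t₀) z) = ∫ y, g y ∂(κ r z) := by
    have hint : Integrable f (((P ^ n) ∘ₖ κ r) z) := by
      have := hfint (r + n * t₀) z
      rwa [h_add, kernel_nat_mul_eq_pow κ h_zero h_add] at this
    rw [h_add, kernel_nat_mul_eq_pow κ h_zero h_add, ← hPdef]
    rw [Kernel.comp_apply] at hint ⊢
    exact Harris.integral_comp_measure (P ^ n) (κ r z) hint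
  rw [hact]
  have hgb : ∀ y, |g y - ∫ w, f w ∂μ| ≤ abar ^ n * C₁ * (1 + V y) := fun y => hskel n y
  have hgi : Integrable g (κ r z) := by
    refine Harris.integrable_of_abs_le_affine hV (hflow' r z) hgm (A := |∫ w, f w ∂μ| + abar ^ n * C₁)
      (B := abar ^ n * C₁) fun y => ?_
    have h1 := hgb y
    have h2 : |g y| ≤ |∫ w, f w ∂μ| + |g y - ∫ w, f w ∂μ| := by
      have := abs_add_le (∫ w, f w ∂μ) (g y - ∫ w, f w ∂μ); rwa [add_sub_cancel] at this
    nlinarith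
  have hVi : Integrable (fun y => (V y : ℝ)) (κ r z) :=
    Harris.integrable_coe_of_lintegral_ne_top hV (hflow' r z)
  have hsub : (∫ y, g y ∂(κ r z)) - ∫ w, f w ∂μ = ∫ y, (g y - ∫ w, f w ∂μ) ∂(κ r z) := by
    rw [integral_sub hgi (integrable_const _), integral_const, probReal_univ, one_smul]
  have hPr : (∫⁻ y, (V y : ℝ≥0∞) ∂(κ r z)).toReal ≤ Real.exp (Cstar * t₀) * V z := by
    have h1 : ∫⁻ y, (V y : ℝ≥0∞) ∂(κ r z) ≤ ENNReal.ofReal (Real.exp (Cstar * t₀) * V z) := by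
      refine (hflow r z).trans ?_
      rw [ENNReal.ofReal_mul (Real.exp_pos _).le, ENNReal.ofReal_coe_nnreal]
      refine mul_le_mul_of_nonneg_right (ENNReal.ofReal_le_ofReal (Real.exp_le_exp.2 ?_)) zero_le
      exact mul_le_mul_of_nonneg_left (by exact_mod_cast hr.le) hCstar
    exact ENNReal.toReal_le_of_le_ofReal (by positivity) h1
  -- `ᾱⁿ ≤ ᾱ⁻¹ e^{-ct}`
  have hpow : abar ^ n ≤ abar⁻¹ * Real.exp (-c * ((r + n * t₀ : ℝ≥0) : ℝ)) := by
    have hlogeq : Real.log abar = -c * t₀ := by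
      rw [hcdef, neg_mul, div_mul_cancel₀ _ ht₀r.ne', neg_neg]
    have hn : abar ^ n = Real.exp (n * Real.log abar) := by
      rw [Real.exp_nat_mul, Real.exp_log ha0]
    have hinv' : abar⁻¹ = Real.exp (c * t₀) := by
      have : Real.exp (c * t₀) = Real.exp (-Real.log abar) := by
        rw [hlogeq]; simp only [neg_mul, neg_neg]
      rw [this, Real.exp_neg, Real.exp_log ha0]
    rw [hn, hinv', ← Real.exp_add]
    refine Real.exp_le_exp.2 ?_
    rw [hlogeq]
    push_cast
    have hr' : ((r : ℝ≥0) : ℝ) ≤ t₀ := by exact_mod_cast hr.le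
    have hc0 : 0 ≤ c := hc.le
    nlinarith [mul_nonneg hc0 (sub_nonneg.2 hr')]
  have hE : 0 ≤ Real.exp (Cstar * t₀) := (Real.exp_pos _).le
  have hE1 : 1 ≤ Real.exp (Cstar * t₀) := Real.one_le_exp (by positivity)
  calc |(∫ y, g y ∂(κ r z)) - ∫ w, f w ∂μ|
      = |∫ y, (g y - ∫ w, f w ∂μ) ∂(κ r z)| := by rw [hsub]
    _ ≤ ∫ y, |g y - ∫ w, f w ∂μ| ∂(κ r z) := abs_integral_le_integral_abs
    _ ≤ ∫ y, abar ^ n * C₁ * (1 + (V y : ℝ)) ∂(κ r z) :=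
        integral_mono (hgi.sub (integrable_const _)).abs
          (((integrable_const _).add hVi).const_mul _) fun y => hgb y
    _ = abar ^ n * C₁ * (1 + (∫⁻ y, (V y : ℝ≥0∞) ∂(κ r z)).toReal) := by
        rw [integral_const_mul, integral_add (integrable_const _) hVi, integral_const,
          probReal_univ, one_smul, Harris.integral_coe_eq_toReal hV]
    _ ≤ abar ^ n * C₁ * (1 + Real.exp (Cstar * t₀) * V z) := by gcongr
    _ ≤ abar ^ n * C₁ * (Real.exp (Cstar * t₀) * (1 + V z)) := by
        refine mul_le_mul_of_nonneg_left ?_ (by positivity)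
        have hVz : (0 : ℝ) ≤ V z := (V z).2
        nlinarith
    _ ≤ (abar⁻¹ * Real.exp (-c * ((r + n * t₀ : ℝ≥0) : ℝ))) * C₁ *
          (Real.exp (Cstar * t₀) * (1 + V z)) := by gcongr
    _ = C₁ * Real.exp (Cstar * t₀) / abar * (1 + V z) *
          Real.exp (-c * ((r + n * t₀ : ℝ≥0) : ℝ)) := by ring

end Skeleton

end Literature.Probability.Process.MarkovSemigroup
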